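import Summits.QuantumFields.BalabanUV.T4Continuum.Support.NE7HapeOfLocalChartWide
import Summits.QuantumFields.BalabanUV.T4Continuum.Support.NE7OneStepOfDecomposition
import HarnessLib

/-!
# GEN 95 RE-THREAD (`…Dec`): this file is `NE7OneStepOfLocalChartWide` VERBATIM except that F31's per-pair binder `hleaves` (row NE3's weight currency,
# numerically refuted for arbitrary pairs — memo `t4/b2b-balaban-t4-ne7-p1-g95/WEIGHT-CURRENCY-DEAD.md`) is replaced by F327's honest binder `hdecomp`
# (decomposition `X = X_T + X_N` with its two energy letters and k-free currencies `(α̂, ν̂, κ̂)`) and route Π's uniform block by ONE k-free line;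
# the chart∕budget content is untouched and chain predecessors are the `…Dec` re-issues.  Original docstring follows.

# NE7 — ONE-STEP ⇐ the local chart (N1)-weak on the WIDE cover ∧ the budget ∧ row NE3's leaves (F283w)

[Balaban1985Variational] Prop 8 ∘ [Balaban1983Laplace] Thm 2 — F283 `NE7OneStepOfLocalChart` with the cover
factor FREE: the composition of

* F31 `NE7OneStepOfRoutePi.oneStep_of_dataClass_ape_routePi` (the SMALL-FIELD ONE-STEP on the data class
  from (APE), row NE3's per-pair binder, the slice Poincaré inequality and route Π's two `k`-free lines);
* F282w `NE7HapeOfLocalChartWide.hape_of_localChart_budget_wide`: (APE) on the data class (every period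
  `N ≥ 1`) from THE LOCAL CHART (N1)-weak — [B8] Thm 2 at `U₀ = 1` on the nested cubes of radius
  `(nbRad + 2ℓ + 10)·M` — stated on the `Kc`-fold cover for ANY `Kc ≥ 4ℓ + 12`, the multi-level class
  smallness, F51's three bounds and the two closed-form budget inequalities of F280.

WHY THE FREE FACTOR (gen 91, `NE7LocalChartCoverObstruction`): on the `(4ℓ+12)`-fold cover of F282∕F283 the
chart ball is the whole torus for small `N` and the chart hypothesis is then refuted by torons; the consumer
of this file takes `Kc ≥ 2·nbRad (d+1) L + 4ℓ + 24`, which makes the chart LOCAL.  Regime as in F283: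
`δ₁ < δ < ε`, `c₀ + θδ ≤ δ`, `c₀∕(1 − θ) < δ₁`.  Asserted for nothing: THE CHART and row NE3's `hleaves`.
-/

open scoped BigOperators Matrix Matrix.Norms.L2Operator
open NormedSpace Finset Set

namespace Summit.QuantumFields.BalabanUV.T4Continuum.NE7OneStepOfLocalChartWideDec

open Literature.MathematicalPhysics.QuantumFieldTheory.Balaban1983to89
open B7Prop1Explicit B7Prop2Explicit MatrixLog UnitaryModel
open B4TorusKernel.MultiPeriod (torusSupNorm)
open T4AveragingDeficitWall (IsUnitaryCfg IsSkewDir SmallField vary curl curlSq dirSq dirL1)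
open T4AveragingDeficitWallBoundary (IsPeriodicCfg periodBox)
open AveragingDeficitPeriodicCounting (IsPeriodicDir)
open AveragingDeficitMultiLevelPrep (LevelSmall tower TangentIter)
open BlockAverageVaryHolo (nbRad)
open BlockAverageVaryDisc (rho0)
open MinimalActionLevels (perWin)
open MinimalActionSandwich (IsMinimiser admissible)
open MinimalActionRate (sfClass)
open NE3HessForm (dAction)
open NE3SlicePoincareShape (SlicePoincare)
open NE3FrameFreeSliceW (frameFreeBlockLandauW)
open NE3TangentCovariantTower (dirIter)
open NE3DecomposedRepOfLinearNormalPart (ResidualSliceRepT)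
open NE3QbarIterCovLiftPrep (cruxC)
open NE3SmoothRightInverseW (rightInvW)
open NE3RightInverseSolveLetters (thetaLoc)
open NE3RightInverseL2Letter (l2C)
open NE3HatInvCurlLetters (curl2C curl1C)
open B4Sect5Proof (latticeConst)
open B5Hk163Strip (kappa163)
open B5Hk163TorusHolderDecay (CdecD)
open NE3EnergyShapes (IsUnitarySite)
open BlockAveragePushDirSplit (flat)
open NE7HapeOfLocalChartWide (hape_of_localChart_budget_wide)
open NE7OneStepOfDecomposition (oneStep_of_dataClass_ape_decomp)
open NE3EnergyWeightedShapes (energyNormW)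

variable {d : ℕ} {n : Type*} [Fintype n] [DecidableEq n]

set_option maxHeartbeats 400000 in
/-- **F283w — ONE-STEP from the local chart on the WIDE cover.**  [Balaban1985Variational] Prop 8 ∘
[Balaban1983Laplace] Thm 2, row NE7: F283's statement with a free cover factor `Kc ≥ 4ℓ + 12` (the chart
hypothesis at period `N·Kc`); proof = F31 ∘ F282w, verbatim as F283 = F31 ∘ F282. -/
theorem oneStep_of_dataClass_chart_routePi_wide [Nonempty n] {L : ℕ} [NeZero L] (hL : 2 ≤ L) :
    ∃ K c : ℝ, 0 ≤ K ∧ 0 < c ∧ ∀ (N ℓ Kc : ℕ) [NeZero N] (ε δ δ₁ CP β c₀ θ C₀ C₁ αh νh κh : ℝ), 1 ≤ N →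
    -- F31's hypotheses (route Π, dimension `d + 1`): class smallness, the regime `δ₁ < δ < ε`, slice Poincaré, the two k-free lines
    0 < ε →
    16 * C0 (d + 1) * ε ≤ 3 →
    1024 * (((d + 1 : ℕ) : ℝ) + 1) * (((d + 1 : ℕ) : ℝ) + 4) * (L : ℝ) ^ 2 * ε ≤ 1 →
    0 ≤ δ₁ →
    δ₁ < δ →
    δ < ε →
    0 < CP →
    0 < β →
    (∀ k : ℕ, LevelSmall (d + 1) L k (ε / ((L : ℝ) ^ (k + 1)) ^ 2)) →
    (∀ (j : ℕ) (W' : Site (d + 1) → Fin (d + 1) → (Matrix n n ℂ)ˣ), W' ∈ sfClass (d + 1) L N ε (j + 1) → SlicePoincare L (j + 1) W' (frameFreeBlockLandauW L N (j + 1) W') CP (periodBox (d := d + 1) (N * L ^ (j + 1)))) →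
    thetaLoc (d + 1) L * ε < 1 →
    ε ≤ 1 →
    -- the k-free ceilings `(α̂, ν̂, κ̂)` of the honest per-pair binder and ONE k-free strict line (F327)
    2 * κh < ((((1 / 2 - νh ^ 2) / (2 * (1 + CP)) - νh ^ 2) / 2 - 576 * ((d + 1 : ℕ) : ℝ) * (αh ^ 2 * Real.exp (2 * αh))) / (Fintype.card n : ℝ) - 28 * ((d + 1 : ℕ) : ℝ) * (ε + 7 * αh ^ 2)) →
    -- F282's hypotheses: the regime of `(c₀, θ)`, `cruxC`, the chart constants, F51's bounds, the budget, THE CHART on the cover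
    1 ≤ ℓ → 4 * ℓ + 12 ≤ Kc →
    0 ≤ c₀ → 0 ≤ θ → θ < 1 → c₀ + θ * δ ≤ δ → c₀ / (1 - θ) < δ₁ →
    cruxC (d + 1) L * ε < 1 →
    -- the chart constants and F51's smallness of `C₀·(δ + 4(e^β − 1) + ε)`
    0 ≤ C₀ → 0 ≤ C₁ →
    4 * (3 + 12 * ((d + 1 : ℕ) : ℝ)) ^ 2 * (C₀ * (δ + 4 * (Real.exp β - 1) + ε)) ≤ rho0 (d + 1) L ^ 2 →
    (8 * (3 + 12 * ((d + 1 : ℕ) : ℝ)) * (2 + 2 * ((((d + 1 : ℕ) : ℝ) + 1) * L)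
        * (1 + ((1250 * ((nbRad (d + 1) L : ℝ) + L) + 8 * (((d + 1 : ℕ) : ℝ) * L) + 2 * L) * (((d + 1 : ℕ) : ℝ) * (2 * nbRad (d + 1) L + 1) ^ (d + 1)))
          / ((L : ℝ) / (L : ℝ) ^ (d + 1))))) * (C₀ * (δ + 4 * (Real.exp β - 1) + ε)) ≤ 1 →
    256 * (((d + 1 : ℕ) : ℝ) + 1) * L * (3 + 12 * ((d + 1 : ℕ) : ℝ)) * (C₀ * (δ + 4 * (Real.exp β - 1) + ε)) ≤ 1 →
    -- THE BUDGET (F280): `C₀T ≤ 1` and the two closed-form inequalities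
    C₀ * (δ + 4 * (Real.exp β - 1) + ε) ≤ 1 →
    ((K * (2 * (curl1C (d + 1) L / (1 - thetaLoc (d + 1) L * ε)) * (8 * (3 + 12 * ((d + 1 : ℕ) : ℝ)) * (2 + 2 * ((((d + 1 : ℕ) : ℝ) + 1) * L)
        * (1 + ((1250 * ((nbRad (d + 1) L : ℝ) + L) + 8 * (((d + 1 : ℕ) : ℝ) * L) + 2 * L) * (((d + 1 : ℕ) : ℝ) * (2 * nbRad (d + 1) L + 1) ^ (d + 1)))
          / ((L : ℝ) / (L : ℝ) ^ (d + 1))))) * (C₀ * (δ + 4 * (Real.exp β - 1) + ε))) + K * Real.exp (-(c * ℓ)) * (2 * (curl1C (d + 1) L / (1 - thetaLoc (d + 1) L * ε)) * (8 * (3 + 12 * ((d + 1 : ℕ) : ℝ)) * (2 + 2 * ((((d + 1 : ℕ) : ℝ) + 1) * L)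
        * (1 + ((1250 * ((nbRad (d + 1) L : ℝ) + L) + 8 * (((d + 1 : ℕ) : ℝ) * L) + 2 * L) * (((d + 1 : ℕ) : ℝ) * (2 * nbRad (d + 1) L + 1) ^ (d + 1)))
          / ((L : ℝ) / (L : ℝ) ^ (d + 1))))) * (C₀ * (δ + 4 * (Real.exp β - 1) + ε)) + (curl1C (d + 1) L / (1 - thetaLoc (d + 1) L * ε))))
      + (K * ((Fintype.card (T4AveragingDeficitWall.Plane (d + 1)) : ℝ) * (((δ + 4 * (Real.exp β - 1) + ε) * (144 * C₀ * C₁ + 8 * C₁ ^ 2) + (δ + 4 * (Real.exp β - 1) + ε) ^ 2 * (5440 * C₀ ^ 3 + 304 * C₁ * C₀ ^ 2) + (δ + 4 * (Real.exp β - 1) + ε) ^ 3 * (2688 * C₀ ^ 4)) + 2 * ((δ + 4 * (Real.exp β - 1) + ε) * (144 * C₀ * (C₀ + C₁) + 8 * (C₀ + C₁) ^ 2) + (δ + 4 * (Real.exp β - 1) + ε) ^ 2 * (5440 * C₀ ^ 3 + 304 * (C₀ + C₁) * C₀ ^ 2) + (δ + 4 * (Real.exp β - 1) + ε) ^ 3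 * (2688 * C₀ ^ 4))))
      + K * Real.exp (-(c * ℓ)) * ((Fintype.card (T4AveragingDeficitWall.Plane (d + 1)) : ℝ) * (((δ + 4 * (Real.exp β - 1) + ε) * (144 * C₀ * C₁ + 8 * C₁ ^ 2) + (δ + 4 * (Real.exp β - 1) + ε) ^ 2 * (5440 * C₀ ^ 3 + 304 * C₁ * C₀ ^ 2) + (δ + 4 * (Real.exp β - 1) + ε) ^ 3 * (2688 * C₀ ^ 4)) + 2 * ((δ + 4 * (Real.exp β - 1) + ε) * (144 * C₀ * (C₀ + C₁) + 8 * (C₀ + C₁) ^ 2) + (δ + 4 * (Real.exp β - 1) + ε) ^ 2 * (5440 * C₀ ^ 3 + 304 * (C₀ + C₁) * C₀ ^ 2) + (δ + 4 * (Real.exp β - 1) + ε) ^ 3 * (2688 * C₀ ^ 4))) + 4 * (Fintype.card (T4AveragingDeficitWall.Plane (d + 1)) : ℝ) * (C₀ + C₁))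
      + (Fintype.card n : ℝ) * (2 * (CdecD d * (((d : ℝ) + 1) * (2 * ((d : ℝ) + 1))
              * ((2 + 32 / (kappa163 (d + 1) / (d + 1)) ^ 2) * latticeConst (d + 1) (kappa163 (d + 1) / (d + 1) / 2))))) * (1 + 12 * ((d : ℝ) + 1)) * ((28 * ((3 + 12 * ((d + 1 : ℕ) : ℝ)) + (4 * (3 + 12 * ((d + 1 : ℕ) : ℝ)) ^ 3 / rho0 (d + 1) L ^ 2) * (C₀ * (δ + 4 * (Real.exp β - 1) + ε))) ^ 2 + 4 * (4 * (3 + 12 * ((d + 1 : ℕ) : ℝ)) ^ 3 / rho0 (d + 1) L ^ 2)) * (C₀ ^ 2 * (δ + 4 * (Real.exp β - 1) + ε)))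
      + ((Fintype.card n : ℝ) * (2 * (CdecD d * (((d : ℝ) + 1) * (latticeConst (d + 1) (kappa163 (d + 1) / (d + 1) / 2) * Real.exp (-(kappa163 (d + 1) / (d + 1) / 2 * ℓ))))))) * ((3 + 12 * ((d + 1 : ℕ) : ℝ)) * C₀ + ((d : ℝ) + 1) * (4 * ((ℓ + 1 : ℕ) : ℝ) + 2) * (2 * (3 + 12 * ((d + 1 : ℕ) : ℝ)) * C₀ + ((28 * ((3 + 12 * ((d + 1 : ℕ) : ℝ)) + (4 * (3 + 12 * ((d + 1 : ℕ) : ℝ)) ^ 3 / rho0 (d + 1) L ^ 2) * (C₀ * (δ + 4 * (Real.exp β - 1) + ε))) ^ 2 + 4 * (4 * (3 + 12 * ((d + 1 : ℕ) : ℝ)) ^ 3 / rho0 (d + 1) L ^ 2)) * (C₀ ^ 2 * (δ + 4 * (Real.exp β - 1) + ε))))) + 28 * C₀ ^ 2 * (δ + 4 * (Real.exp β - 1) + ε)) ≤ θ) →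
    ((K * ((Fintype.card (T4AveragingDeficitWall.Plane (d + 1)) : ℝ) * (((δ + 4 * (Real.exp β - 1) + ε) * (144 * C₀ * C₁ + 8 * C₁ ^ 2) + (δ + 4 * (Real.exp β - 1) + ε) ^ 2 * (5440 * C₀ ^ 3 + 304 * C₁ * C₀ ^ 2) + (δ + 4 * (Real.exp β - 1) + ε) ^ 3 * (2688 * C₀ ^ 4)) + 2 * ((δ + 4 * (Real.exp β - 1) + ε) * (144 * C₀ * (C₀ + C₁) + 8 * (C₀ + C₁) ^ 2) + (δ + 4 * (Real.exp β - 1) + ε) ^ 2 * (5440 * C₀ ^ 3 + 304 * (C₀ + C₁) * C₀ ^ 2) + (δ + 4 * (Real.exp β - 1) + ε) ^ 3 * (2688 * C₀ ^ 4))))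
      + K * Real.exp (-(c * ℓ)) * ((Fintype.card (T4AveragingDeficitWall.Plane (d + 1)) : ℝ) * (((δ + 4 * (Real.exp β - 1) + ε) * (144 * C₀ * C₁ + 8 * C₁ ^ 2) + (δ + 4 * (Real.exp β - 1) + ε) ^ 2 * (5440 * C₀ ^ 3 + 304 * C₁ * C₀ ^ 2) + (δ + 4 * (Real.exp β - 1) + ε) ^ 3 * (2688 * C₀ ^ 4)) + 2 * ((δ + 4 * (Real.exp β - 1) + ε) * (144 * C₀ * (C₀ + C₁) + 8 * (C₀ + C₁) ^ 2) + (δ + 4 * (Real.exp β - 1) + ε) ^ 2 * (5440 * C₀ ^ 3 + 304 * (C₀ + C₁) * C₀ ^ 2) + (δ + 4 * (Real.exp β - 1) + ε) ^ 3 * (2688 * C₀ ^ 4))) + 4 * (Fintype.card (T4AveragingDeficitWall.Plane (d + 1)) : ℝ) * (C₀ + C₁))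
      + (Fintype.card n : ℝ) * (2 * (CdecD d * (((d : ℝ) + 1) * (2 * ((d : ℝ) + 1))
              * ((2 + 32 / (kappa163 (d + 1) / (d + 1)) ^ 2) * latticeConst (d + 1) (kappa163 (d + 1) / (d + 1) / 2))))) * (1 + 12 * ((d : ℝ) + 1)) * ((28 * ((3 + 12 * ((d + 1 : ℕ) : ℝ)) + (4 * (3 + 12 * ((d + 1 : ℕ) : ℝ)) ^ 3 / rho0 (d + 1) L ^ 2) * (C₀ * (δ + 4 * (Real.exp β - 1) + ε))) ^ 2 + 4 * (4 * (3 + 12 * ((d + 1 : ℕ) : ℝ)) ^ 3 / rho0 (d + 1) L ^ 2)) * (C₀ ^ 2 * (δ + 4 * (Real.exp β - 1) + ε)))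
      + ((Fintype.card n : ℝ) * (2 * (CdecD d * (((d : ℝ) + 1) * (latticeConst (d + 1) (kappa163 (d + 1) / (d + 1) / 2) * Real.exp (-(kappa163 (d + 1) / (d + 1) / 2 * ℓ))))))) * ((3 + 12 * ((d + 1 : ℕ) : ℝ)) * C₀ + ((d : ℝ) + 1) * (4 * ((ℓ + 1 : ℕ) : ℝ) + 2) * (2 * (3 + 12 * ((d + 1 : ℕ) : ℝ)) * C₀ + ((28 * ((3 + 12 * ((d + 1 : ℕ) : ℝ)) + (4 * (3 + 12 * ((d + 1 : ℕ) : ℝ)) ^ 3 / rho0 (d + 1) L ^ 2) * (C₀ * (δ + 4 * (Real.exp β - 1) + ε))) ^ 2 + 4 * (4 * (3 + 12 * ((d + 1 : ℕ) : ℝ)) ^ 3 / rho0 (d + 1) L ^ 2)) * (C₀ ^ 2 * (δ + 4 * (Real.exp β - 1) + ε))))) + 28 * C₀ ^ 2 * (δ + 4 * (Real.exp β - 1) + ε)) * (4 * (Real.exp β - 1) + ε)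
      + ((Fintype.card n : ℝ) * (2 * (CdecD d * (((d : ℝ) + 1) * (2 * ((d : ℝ) + 1))
              * ((2 + 32 / (kappa163 (d + 1) / (d + 1)) ^ 2) * latticeConst (d + 1) (kappa163 (d + 1) / (d + 1) / 2))))) * (1 + 12 * ((d : ℝ) + 1)) + ((Fintype.card n : ℝ) * (2 * (CdecD d * (((d : ℝ) + 1) * (latticeConst (d + 1) (kappa163 (d + 1) / (d + 1) / 2) * Real.exp (-(kappa163 (d + 1) / (d + 1) / 2 * ℓ))))))) * (((d : ℝ) + 1) * (4 * ((ℓ + 1 : ℕ) : ℝ) + 2))) * (4 * (Real.exp β - 1)) ≤ c₀) →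
    -- THE CHART (N1)-weak: [B8] Thm 2 at `U₀ = 1` on nested cubes, TYPE (asserted for nothing here)
    (∀ D : Site (d + 1) → Fin (d + 1) → (Matrix n n ℂ)ˣ, IsUnitaryCfg D → IsPeriodicCfg D ((N * Kc) : ℤ) → SmallField D (4 * (Real.exp β - 1)) →
      ∀ (k : ℕ), ∀ U ∈ admissible (sfClass (d + 1) L (N * Kc) ε) L (k + 1) D,
      (∀ φ : Site (d + 1) → Fin (d + 1) → Matrix n n ℂ, IsSkewDir φ → IsPeriodicDir φ (((N * Kc) * L ^ (k + 1) : ℕ) : ℤ) → TangentIter L k U φ →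
        dAction U φ (perWin (d + 1) ((N * Kc) * L ^ (k + 1))) = 0) →
      ∀ r : ℝ, 0 ≤ r → r ≤ δ → SmallField U (r / ((L : ℝ) ^ (k + 1)) ^ 2) →
      ∀ z : Site (d + 1), ∃ (u : Site (d + 1) → (Matrix n n ℂ)ˣ) (At : Site (d + 1) → Fin (d + 1) → Matrix n n ℂ) (a₀ a₁ : ℝ),
        IsUnitarySite u ∧ (∀ (y : Site (d + 1)) (i : Fin (d + 1)), u (y + (((N * Kc) * L ^ (k + 1) : ℕ) : ℤ) • e i) = u y) ∧
        IsSkewDir At ∧ IsPeriodicDir At (((N * Kc) * L ^ (k + 1) : ℕ) : ℤ) ∧ 0 ≤ a₀ ∧ 0 ≤ a₁ ∧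
        (∀ (y : Site (d + 1)) (κ : Fin (d + 1)), ‖At y κ‖ ≤ a₀) ∧ (∀ (y : Site (d + 1)) (κ τ : Fin (d + 1)), ‖At (y + e τ) κ - At y κ‖ ≤ a₁) ∧
        (L : ℝ) ^ (k + 1) * a₀ ≤ C₀ * (r + 4 * (Real.exp β - 1) + ε) ∧ ((L : ℝ) ^ (k + 1)) ^ 2 * a₁ ≤ C₁ * (r + 4 * (Real.exp β - 1) + ε) ∧
        (∀ (y : Site (d + 1)) (κ : Fin (d + 1)),
          torusSupNorm (fun _ : Fin (d + 1) => L ^ (k + 1) * (N * Kc)) (y - z) ≤ (((nbRad (d + 1) L + 2 * ℓ + 10) * L ^ (k + 1) : ℕ) : ℝ) →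
            gaugeAct u U y κ = vary (flat (d := d + 1) (n := n)) At 1 y κ)) →
    -- THE HONEST PER-PAIR BINDER `hdecomp` on the data class (F327's, dimension `d + 1`)
    (∀ D : Site (d + 1) → Fin (d + 1) → (Matrix n n ℂ)ˣ, IsUnitaryCfg D → IsPeriodicCfg D (N : ℤ) → SmallField D (4 * (Real.exp β - 1)) → ∀ (k : ℕ), ∀ Us ∈ admissible (sfClass (d + 1) L N ε) L (k + 1) D, SmallField Us (δ₁ / ((L : ℝ) ^ (k + 1)) ^ 2) → (∀ φ : Site (d + 1) → Fin (d + 1) → Matrix n n ℂ, IsSkewDir φ → IsPeriodicDir φ ((N * L ^ (k + 1) : ℕ) : ℤ) → TangentIter L k Us φ → dAction Us φ (perWin (d + 1) (N * L ^ (k + 1))) = 0) → ∀ U' ∈ admissible (sfClass (d + 1) L N ε) L (k + 1) D, 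
      ∃ (u : Site (d + 1) → (Matrix n n ℂ)ˣ) (X XT XN : Site (d + 1) → Fin (d + 1) → Matrix n n ℂ) (α ν κ : ℝ),
        IsUnitarySite u ∧ IsSkewDir X ∧ IsPeriodicDir X ((N * L ^ (k + 1) : ℕ) : ℤ) ∧ 0 ≤ α ∧ (∀ x μ, ‖X x μ‖ ≤ α) ∧
        gaugeAct u U' = vary Us X 1 ∧
        X = XT + XN ∧ XT ∈ frameFreeBlockLandauW (d := d + 1) (n := n) L N (k + 1) Us ∧ IsSkewDir XN ∧ 0 ≤ ν ∧
        energyNormW L (k + 1) Us XN (periodBox (d := d + 1) (N * L ^ (k + 1)))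
          ≤ ν * energyNormW L (k + 1) Us X (periodBox (d := d + 1) (N * L ^ (k + 1))) ∧
        ε / ((L : ℝ) ^ (k + 1)) ^ 2 * (∑ p ∈ perWin (d + 1) (N * L ^ (k + 1)), ‖curl Us XN p‖)
          ≤ κ * energyNormW L (k + 1) Us X (periodBox (d := d + 1) (N * L ^ (k + 1))) ^ 2 ∧
        α * (L : ℝ) ^ (k + 1) ≤ αh ∧ ν ≤ νh ∧ κ ≤ κh) →
    ∃ γ : ℝ, 0 < γ ∧ ∀ V : Site (d + 1) → Fin (d + 1) → (Matrix n n ℂ)ˣ, IsUnitaryCfg V → IsPeriodicCfg V (N : ℤ) → SmallField V γ →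
      ∀ (k : ℕ) (U₀ : Site (d + 1) → Fin (d + 1) → (Matrix n n ℂ)ˣ), U₀ ∈ admissible (sfClass (d + 1) L N ε) L (k + 1) V →
        SmallField U₀ (δ / ((L : ℝ) ^ k) ^ 2) →
        ∃ U, IsMinimiser (d + 1) (sfClass (d + 1) L N ε) L N (k + 1) V U ∧ SmallField U (δ / ((L : ℝ) ^ (k + 1)) ^ 2)
  := by
  obtain ⟨K, c, hK, hc, hF⟩ := hape_of_localChart_budget_wide (d := d) (n := n) hL
  refine ⟨K, c, hK, hc, ?_⟩
  intro N ℓ Kc _ ε δ δ₁ CP β c₀ θ C₀ C₁ αh νh κh hN hε hε1 hε2 hδ₁ hδ₁δ hδε hCP hβ hls hP hθl hε1' hline hℓ hKc hc₀ hθ0 hθ1 hcδ hcδ₁ hθc hC₀ hC₁ hσ hKd hS hC₀T hbr hbc hchart hdecomp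
  exact oneStep_of_dataClass_ape_decomp (d := d + 1) hL hN hε hε1 hε2 hδ₁ hδ₁δ hδε hCP hβ hls hP hline
    (hF N ℓ Kc ε δ δ₁ β c₀ θ C₀ C₁ hℓ hKc hc₀ hθ0 hθ1 hcδ hcδ₁ hβ.le hε.le hε1' hθc hθl hls hC₀ hC₁ hσ hKd hS hC₀T hbr hbc hchart)
    hdecomp

end Summit.QuantumFields.BalabanUV.T4Continuum.NE7OneStepOfLocalChartWideDec
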